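import Summits.BirchSwinnertonDyer.BirchSwinnertonDyer.Theorems.ResidualThetaTransportAtTwoThetaLayerLambdaCongruenceAtTwoCuspSpanGeneration
import HarnessLib

/-!
# Route `ResidualThetaTransportAtTwo`, cruxes Kan⁺ (stmt-BirchSwinnertonDyer-20688) / 21437: `CuspSpanEvenAtTwo N` for the prime squares / powers
# `N = 243 = 3⁵`, `361 = 19²` (Theorem A family, finite check by `decide`)

Cell `bsd-wall`, lead prover `bsd-wall-rtt-p3` g9 (2026-08-28). THEOREMS ONLY; `--supports stmt-BirchSwinnertonDyer-20688`; BSD is not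
proved by this. `243 = 3⁵` is the largest power of `3` that occurs as a conductor exponent part (`v₃(N_W) ≤ 5`); `2` generates
`(ℤ/3^e)ˣ` for every `e`, so `±⟨4⟩ = (ℤ/243)ˣ` and Theorem A (`cuspSpanEvenAtTwo_of_primePow_of_finiteCheck`) applies; the finite
check `K = 81` is discharged by `decide`. Likewise `361 = 19²` (`ord 2 = 342 = φ`, `−1 = 2^{171} ∉ ⟨4⟩`, `K = 171`): `±⟨4⟩ = (ℤ/361)ˣ`
(`529 = 23²`, `K = 253`, also satisfies (U4) but its `decide` exceeds the default heartbeats — not included).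

References: [Rademacher1929] §1; [Pollack2003] Conj. 6.3.
-/

set_option autoImplicit false
set_option linter.dupNamespace false

open scoped MatrixGroups

open CongruenceSubgroup

namespace Summit.BirchSwinnertonDyer.BirchSwinnertonDyer.Theorems.SignedMuAtTwo

set_option maxRecDepth 16384 in
/-- **`CuspSpanEvenAtTwo 243`** (`243 = 3⁵`, Theorem A: every unit mod `243` is `±4^k`, `k ≤ 81`). [cite: Pollack2003, Conj. 6.3] -/
theorem cuspSpanEvenAtTwo_twohundredfortythree : CuspSpanEvenAtTwo 243 := by
  have h : CuspSpanEvenAtTwo (3 ^ 5) :=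
    cuspSpanEvenAtTwo_of_primePow_of_finiteCheck (p := 3) (e := 5) (by norm_num) 81 (by decide)
  simpa using h

set_option maxRecDepth 65536 in
/-- **`CuspSpanEvenAtTwo 361`** (`361 = 19²`, Theorem A: every unit mod `361` is `±4^k`, `k ≤ 171`). [cite: Pollack2003, Conj. 6.3] -/
theorem cuspSpanEvenAtTwo_threehundredsixtyone : CuspSpanEvenAtTwo 361 := by
  have h : CuspSpanEvenAtTwo (19 ^ 2) :=
    cuspSpanEvenAtTwo_of_primePow_of_finiteCheck (p := 19) (e := 2) (by norm_num) 171 (by decide)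
  simpa using h

end Summit.BirchSwinnertonDyer.BirchSwinnertonDyer.Theorems.SignedMuAtTwo
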